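import Summits.QuantumFields.BalabanUV.Beta.GAN24.ResolventLegCharges
import Summits.QuantumFields.BalabanUV.Beta.GAN24.CompositeStencilChargeZero
import Summits.QuantumFields.BalabanUV.Beta.GAN24.E3UnitSplit

/-!
# `BalabanUV.Beta.GAN24.ValueJetChargeZero` — row G-an2-4 ∕ (CONV-C), W-slot, SKELETON-W3 §7.2 SUM RULE (S3c), PART 2b (the END of «W3-S3C*»):
# THE VALUE-FUNCTION THIRD JET `e3Of m` ON TWO CONSTANT FIELD LEGS VANISHES — ALL THREE LEG PAIRS, EVERY MEMBER, EVERY `d`, `Lc ≥ 1`, ALL `cE cVH cΛ`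

NOT IN PRINT; OUR PROOF ATTEMPT (idle-seat one-shot kernel lemma under the row owner's RULINGS-13 invitation «W3-S3C*», unit
`b2b-balaban-gan24-formalise-leaf-06`, gen 8; RULINGS-14 «continue to `e3Of m`»).  HONEST FRAMING (cell contract, verbatim): «discharging `BetaPertH`
makes Bałaban's UV stability UNCONDITIONAL — a real constructive-QFT result; it is NOT the continuum limit and NOT the Clay problem.»  HONEST
DEPENDENCY (verbatim): «continuum YM on T⁴ ⇐ BetaPertH ∧ nine spine estimates (0/9 proved); BetaPertH ⇐ (D1) ∧ (D4) ∧ CAP+tail; G-an2-4 gates asym,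
D1 and NE2/3/4.»

WHAT ([folklore] exact identities about an2's DEFINED objects; 0 `def`, 0 cite, 0 sorry):
* §1 `hasSum_e3OfS_inl_inl`: for ANY blocking `N ≥ 1` and ANY local stencil family `S` whose field–field blocks have zero double-leg sums, the third-jet
  functional `E3UnitSplit.e3OfS N S κ′ u′ = −mmRead N (KInv ∘ vertexOf S κ′ u′ ∘ KInv)` has ZERO field–field double-leg sum: the sandwich read-out
  (`ResolventLegCharges.hasSum_sandwich_readout_KInv`: only `−N^{−2(d+2)}·Σ' (vertexOf S κ′ u′)_ff` survives) × PART 1b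
  (`CompositeStencilChargeZero.hasSum_vertexOf_inl_inl`: that sum is zero);
* §2 **`hasSum_e3Of_inl_inl`** ∕ `tsum_tsum_e3Of_inl_inl`: an2's `BalabanStepJetsSucc.e3Of d Lc cE cVH cΛ m κ′ u′` — EVERY member `m` (`e3Of m = e3OfS (Lc^m) (Sc (m−1))`,
  `E3UnitSplit.e3Of_eq_e3OfS`; PART 1b `hasSum_Sc_inl_inl`) — has zero field–field double-leg sum: THE KERNEL-LEG PAIR of (S3c);
* §3 THE TWO MIXED LEG PAIRS for members `m = j + 1 ≥ 1` (`hasSum_e3Of_bond_snd`, `hasSum_e3Of_bond_fst` + iterated forms): summing the TABLE (bond) leg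
  `u′` together with either kernel leg also gives zero — by the translation covariance `BalabanStepJetsSucc.e3Of_translate` (all translations of the
  step-`(j+1)` lattice) the family is a shear-reindexing of the kernel-leg family of §2 (`Equiv.prodShear`).
READING (docstring level, asserted nowhere): with the site-free minimiser charges (Q-lin) this is the input (S3c)_{m} of the W-slot's level-`m` zero-mode
calculus (SKELETON-W3 v1.0 §7.2: the first FIELD table `S̃_m ∋ e3Of m` contracted with two constant field legs has zero ff-part — the normalisation
`unitS` is a scalar on the ff block and changes nothing).  Asserts NO shape of Bałaban's tables, pins no colour constant, is NOT (T-irr)∕(F3), discharges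
NOTHING of «T2Shape»∕«T2SupRate»∕(hW, hWall).  NOT «W-slot closed», NEVER «G-an2-4 closed»; NOT BetaPertH, NOT continuum, NOT Clay.
-/

noncomputable section

open Finset
open scoped BigOperators
open Literature.MathematicalPhysics.QuantumFieldTheory
open Literature.MathematicalPhysics.QuantumFieldTheory.Balaban1983to89
open Literature.MathematicalPhysics.QuantumFieldTheory.Balaban1983to89.Beta
open B12Sec2to5 (l1 l1_nonneg)
open ExpKernelCalculus (Site MKer BiLoc Decays VertexFamily comp shiftK)
open OneStepResolventKernel (Fib LocStencil KInv vertexOf vertexFamily_vertexOf')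
open BalabanCompositeJets (Sc locStencil_Sc)
open BalabanStepJetsSucc (e3Of mmRead mmRead_inl_inl locStencil_e3Of e3Of_translate)
open Summit.QuantumFields.BalabanUV.Beta.GAN24.E3UnitSplit (e3OfS e3Of_eq_e3OfS)
open Summit.QuantumFields.BalabanUV.Beta.GAN24.KernelLegCharges (summable_prod_of_biLoc tsum_prod_eq_tsum_tsum_of_biLoc)
open Summit.QuantumFields.BalabanUV.Beta.GAN24.CompositeStencilChargeZero (hasSum_vertexOf_inl_inl tsum_Sc_inl_inl)
open Summit.QuantumFields.BalabanUV.Beta.GAN24.ResolventLegCharges (hasSum_sandwich_readout_KInv)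

namespace Summit.QuantumFields.BalabanUV.Beta.GAN24.ValueJetChargeZero

variable {d : ℕ}

/-! ## §1 The third-jet functional of a stencil family with zero field–field totals -/

section Functional

variable {N : ℕ} [NeZero N]

/-- [folklore] **`e3OfS N S κ′ u′` HAS ZERO FIELD–FIELD DOUBLE-LEG SUM** whenever every `S κ u` has (local stencil family, rate `> 0`). -/
theorem hasSum_e3OfS_inl_inl {S : Fin (d + 1) → Site (d + 1) → MKer (d + 1) (Fib d)} {Cs δ : ℝ} (hS : LocStencil S Cs δ) (hδ : 0 < δ)
    {α β : Fin (d + 1)} (h0 : ∀ κ u, ∑' xz : Site (d + 1) × Site (d + 1), S κ u xz.1 xz.2 (Sum.inl α) (Sum.inl β) = 0)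
    (κ' : Fin (d + 1)) (u' : Site (d + 1)) :
    HasSum (fun xz : Site (d + 1) × Site (d + 1) => e3OfS N S κ' u' xz.1 xz.2 (Sum.inl α) (Sum.inl β)) 0 := by
  obtain ⟨Cv, δv, hδv, hVf⟩ := vertexFamily_vertexOf' (N := N) hS hδ
  have hV : BiLoc (vertexOf (N := N) S κ' u') ((N : ℤ) • u') ((N : ℤ) • u') Cv δv := hVf κ' u'
  have hread := hasSum_sandwich_readout_KInv (N := N) hV hδv α β
  have hz : ∑' yw : Site (d + 1) × Site (d + 1), vertexOf (N := N) S κ' u' yw.1 yw.2 (Sum.inl α) (Sum.inl β) = 0 :=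
    (hasSum_vertexOf_inl_inl (N := N) hS hδ h0 κ' u').tsum_eq
  rw [hz, mul_zero] at hread
  have h := hread.neg
  rw [neg_zero] at h
  refine h.congr_fun fun xz => ?_
  simp only [e3OfS, mmRead_inl_inl]

/-- [folklore] … in `tsum` form over the product. -/
theorem tsum_e3OfS_inl_inl {S : Fin (d + 1) → Site (d + 1) → MKer (d + 1) (Fib d)} {Cs δ : ℝ} (hS : LocStencil S Cs δ) (hδ : 0 < δ)
    {α β : Fin (d + 1)} (h0 : ∀ κ u, ∑' xz : Site (d + 1) × Site (d + 1), S κ u xz.1 xz.2 (Sum.inl α) (Sum.inl β) = 0)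
    (κ' : Fin (d + 1)) (u' : Site (d + 1)) :
    ∑' xz : Site (d + 1) × Site (d + 1), e3OfS N S κ' u' xz.1 xz.2 (Sum.inl α) (Sum.inl β) = 0 :=
  (hasSum_e3OfS_inl_inl hS hδ h0 κ' u').tsum_eq

end Functional

/-! ## §2 (S3c), KERNEL-LEG PAIR: an2's `e3Of m` summed over both kernel legs vanishes, every member `m` -/

section Kernel

variable {Lc : ℕ} [NeZero Lc]

/-- [folklore] **(S3c) — THE VALUE-FUNCTION THIRD JET ON TWO CONSTANT KERNEL LEGS VANISHES**: for every member `m`, bond `(κ′, u′)` and directions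
`α, β`, `HasSum ((x′, z′) ↦ e3Of d Lc cE cVH cΛ m κ′ u′ x′ z′ (inl α) (inl β)) 0`. -/
theorem hasSum_e3Of_inl_inl (hLc : 1 ≤ Lc) (cE cVH cΛ : ℝ) (m : ℕ) (κ' : Fin (d + 1)) (u' : Site (d + 1)) (α β : Fin (d + 1)) :
    HasSum (fun xz : Site (d + 1) × Site (d + 1) => e3Of d Lc cE cVH cΛ m κ' u' xz.1 xz.2 (Sum.inl α) (Sum.inl β)) 0 := by
  obtain ⟨Cs, δ, hδ, hS⟩ := locStencil_Sc (d := d) (Lc := Lc) hLc cE cVH cΛ (m - 1)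
  rw [e3Of_eq_e3OfS]
  exact hasSum_e3OfS_inl_inl hS hδ (fun κ u => tsum_Sc_inl_inl hLc cE cVH cΛ (m - 1) κ u α β) κ' u'

/-- [folklore] (S3c), kernel-leg pair, `tsum` over the product. -/
theorem tsum_e3Of_inl_inl (hLc : 1 ≤ Lc) (cE cVH cΛ : ℝ) (m : ℕ) (κ' : Fin (d + 1)) (u' : Site (d + 1)) (α β : Fin (d + 1)) :
    ∑' xz : Site (d + 1) × Site (d + 1), e3Of d Lc cE cVH cΛ m κ' u' xz.1 xz.2 (Sum.inl α) (Sum.inl β) = 0 :=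
  (hasSum_e3Of_inl_inl hLc cE cVH cΛ m κ' u' α β).tsum_eq

/-- [folklore] (S3c), kernel-leg pair, ITERATED form: `Σ'_{x′} Σ'_{z′} e3Of … m κ′ u′ x′ z′ (inl α) (inl β) = 0`. -/
theorem tsum_tsum_e3Of_inl_inl (hLc : 1 ≤ Lc) (cE cVH cΛ : ℝ) (m : ℕ) (κ' : Fin (d + 1)) (u' : Site (d + 1)) (α β : Fin (d + 1)) :
    ∑' x', ∑' z', e3Of d Lc cE cVH cΛ m κ' u' x' z' (Sum.inl α) (Sum.inl β) = 0 := by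
  obtain ⟨Cs, δ, hδ, hS⟩ := locStencil_e3Of (d := d) (Lc := Lc) hLc cE cVH cΛ m
  rw [← tsum_prod_eq_tsum_tsum_of_biLoc (hS κ' u') hδ]
  exact tsum_e3Of_inl_inl hLc cE cVH cΛ m κ' u' α β

end Kernel

/-! ## §3 (S3c), THE TWO MIXED LEG PAIRS (members `j + 1`): table leg + one kernel leg -/

section Mixed

variable {Lc : ℕ} [NeZero Lc]

/-- [folklore] Translation covariance, entrywise: `e3Of … (j+1) κ′ u′ x′ z′ = e3Of … (j+1) κ′ 0 (x′ − u′) (z′ − u′)`. -/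
theorem e3Of_succ_apply_eq_zero_bond (hLc : 1 ≤ Lc) (cE cVH cΛ : ℝ) (j : ℕ) (κ' : Fin (d + 1)) (u' x' z' : Site (d + 1)) (a b : Fib d) :
    e3Of d Lc cE cVH cΛ (j + 1) κ' u' x' z' a b = e3Of d Lc cE cVH cΛ (j + 1) κ' 0 (x' - u') (z' - u') a b := by
  have h := e3Of_translate (d := d) (Lc := Lc) hLc cE cVH cΛ j κ' 0 u'
  rw [zero_add] at h
  rw [h]
  simp only [shiftK, sub_eq_add_neg]

/-- [folklore] **(S3c), TABLE LEG + SECOND KERNEL LEG**: for every fixed first kernel leg `(α, x′)`,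
`HasSum ((u′, z′) ↦ e3Of … (j+1) κ′ u′ x′ z′ (inl α) (inl β)) 0` — a shear-reindexing of the kernel-leg pair at bond `0`. -/
theorem hasSum_e3Of_bond_snd (hLc : 1 ≤ Lc) (cE cVH cΛ : ℝ) (j : ℕ) (κ' : Fin (d + 1)) (x' : Site (d + 1)) (α β : Fin (d + 1)) :
    HasSum (fun uz : Site (d + 1) × Site (d + 1) => e3Of d Lc cE cVH cΛ (j + 1) κ' uz.1 x' uz.2 (Sum.inl α) (Sum.inl β)) 0 := by
  have h0 := hasSum_e3Of_inl_inl (d := d) hLc cE cVH cΛ (j + 1) κ' 0 α β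
  -- the shear `(u′, z′) ↦ (x′ − u′, z′ − u′)`
  let e : Site (d + 1) × Site (d + 1) ≃ Site (d + 1) × Site (d + 1) :=
    Equiv.prodShear (Equiv.subLeft x') (fun u' => Equiv.subRight u')
  have h1 := (e.hasSum_iff (f := fun xz : Site (d + 1) × Site (d + 1) =>
    e3Of d Lc cE cVH cΛ (j + 1) κ' 0 xz.1 xz.2 (Sum.inl α) (Sum.inl β))).2 h0
  refine h1.congr_fun fun uz => ?_
  rw [e3Of_succ_apply_eq_zero_bond hLc]
  rfl

/-- [folklore] **(S3c), TABLE LEG + FIRST KERNEL LEG**: for every fixed second kernel leg `(β, z′)`,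
`HasSum ((u′, x′) ↦ e3Of … (j+1) κ′ u′ x′ z′ (inl α) (inl β)) 0`. -/
theorem hasSum_e3Of_bond_fst (hLc : 1 ≤ Lc) (cE cVH cΛ : ℝ) (j : ℕ) (κ' : Fin (d + 1)) (z' : Site (d + 1)) (α β : Fin (d + 1)) :
    HasSum (fun ux : Site (d + 1) × Site (d + 1) => e3Of d Lc cE cVH cΛ (j + 1) κ' ux.1 ux.2 z' (Sum.inl α) (Sum.inl β)) 0 := by
  have h0 := hasSum_e3Of_inl_inl (d := d) hLc cE cVH cΛ (j + 1) κ' 0 α β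
  -- the shear `(u′, x′) ↦ (x′ − u′, z′ − u′)`: first `(u′, x′) ↦ (z′ − u′, x′ − u′)`, then swap
  let e : Site (d + 1) × Site (d + 1) ≃ Site (d + 1) × Site (d + 1) :=
    (Equiv.prodShear (Equiv.subLeft z') (fun u' => Equiv.subRight u')).trans (Equiv.prodComm _ _)
  have h1 := (e.hasSum_iff (f := fun xz : Site (d + 1) × Site (d + 1) =>
    e3Of d Lc cE cVH cΛ (j + 1) κ' 0 xz.1 xz.2 (Sum.inl α) (Sum.inl β))).2 h0
  refine h1.congr_fun fun ux => ?_
  rw [e3Of_succ_apply_eq_zero_bond hLc]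
  rfl

/-- [folklore] (S3c), table leg + second kernel leg, ITERATED: `Σ'_{u′} Σ'_{z′} e3Of … (j+1) κ′ u′ x′ z′ (inl α) (inl β) = 0`. -/
theorem tsum_tsum_e3Of_bond_snd (hLc : 1 ≤ Lc) (cE cVH cΛ : ℝ) (j : ℕ) (κ' : Fin (d + 1)) (x' : Site (d + 1)) (α β : Fin (d + 1)) :
    ∑' u', ∑' z', e3Of d Lc cE cVH cΛ (j + 1) κ' u' x' z' (Sum.inl α) (Sum.inl β) = 0 := by
  have h := hasSum_e3Of_bond_snd (d := d) hLc cE cVH cΛ j κ' x' α β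
  rw [← h.summable.tsum_prod]
  exact h.tsum_eq

/-- [folklore] (S3c), table leg + first kernel leg, ITERATED: `Σ'_{u′} Σ'_{x′} e3Of … (j+1) κ′ u′ x′ z′ (inl α) (inl β) = 0`. -/
theorem tsum_tsum_e3Of_bond_fst (hLc : 1 ≤ Lc) (cE cVH cΛ : ℝ) (j : ℕ) (κ' : Fin (d + 1)) (z' : Site (d + 1)) (α β : Fin (d + 1)) :
    ∑' u', ∑' x', e3Of d Lc cE cVH cΛ (j + 1) κ' u' x' z' (Sum.inl α) (Sum.inl β) = 0 := by
  have h := hasSum_e3Of_bond_fst (d := d) hLc cE cVH cΛ j κ' z' α β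
  rw [← h.summable.tsum_prod]
  exact h.tsum_eq

end Mixed

end Summit.QuantumFields.BalabanUV.Beta.GAN24.ValueJetChargeZero

end
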